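import Mathlib.Analysis.Calculus.LineDeriv.IntegrationByParts
import Mathlib.Analysis.Calculus.UniformLimitsDeriv
import Mathlib.MeasureTheory.Integral.Bochner.ContinuousLinearMap
import Literature.Analysis.FluidPDE.SingularKernelTruncation
import HarnessLib

/-!
# `C¹` regularity of singular potentials `∫ K(x − y) f(y) dy` for Hölder densities

Topic `Literature/Analysis/FluidPDE`. Second half of the regularity theory begun in
`SingularKernelTruncation.lean`: for a singular kernel `K : ℝ³ → (V →L[ℝ] W)` of degree `−2`
(`IsC1SingularKernel K A`) and a compactly supported `γ`-Hölder density `f`, `0 < γ`, the potential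
`v = singularPotential K f`, `v(x) = ∫ K(x − y) f(y) dy` (the Biot–Savart velocity when `K = K₃`,
Majda–Bertozzi, *Vorticity and Incompressible Flow* (CUP 2002), (2.94), (4.2)), is continuously
differentiable, with the derivative given by absolutely convergent integrals:
`∇v(x) e = ∫ (∇K(x − y) e)(f y − χ(y) f x) dy + ∫ (∂ₑχ)(y) K(x − y) f(x) dy`, where `χ` is a
smooth cutoff equal to `1` near `supp f ∪ {x}`. This is the classical differentiation formula for
Newtonian-type potentials of Hölder densities, Gilbarg–Trudinger, *Elliptic PDE of Second
Order*, §4.1 **Lemma 4.2**, (4.9) (with the boundary integral `−f(x)∫_{∂Ω₀} D_iΓ ν_j` replaced by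
the equivalent smooth-cutoff term — no surface integrals and no principal values are needed),
and the rigorous form of Majda–Bertozzi §2.4.2–2.4.3, Prop. 2.17/2.20, (4.49):
"`∇v(x) = PV ∫ P_N(x − y) ω(y) dy + c ω(x)`".

## The argument (Gilbarg–Trudinger, proof of Lemma 4.2)

With the smooth truncations `K_ε` of `SingularKernelTruncation.lean`, the regularised potentials
`v_ε = truncPotential K ε f` are differentiable with `∇v_ε(x) = ∫ (∇K_ε(x−y) ·)(f y) dy`
(`hasFDerivAt_truncPotential`) and `v_ε → v` uniformly
(`norm_truncPotential_sub_singularPotential_le`). Split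
`∇v_ε(x) e = ∫ (∇K_ε(x−y) e)(f y − χ y • f x) dy + ∫ (∂ₑχ)(y) K_ε(x−y) f(x) dy`
(`truncGrad_eq`: linearity and one integration by parts in `y`, Mathlib
`integral_smul_fderiv_eq_neg_fderiv_smul_of_integrable`). For `x` in the ball `B(x₀, ρ/2)`,
where `χ = radialCutoff ρ (2ρ) (· − x₀) ≡ 1` on `B(x, ρ/2)`, and `ε ≤ ρ/4`: the second term
already equals its limit (`∇χ = 0` where `K_ε ≠ K`), and the first differs from its limit by an
integral over `|x − y| ≤ 2ε` of `A(2+2B)|x−y|⁻³ · C|x−y|^γ`, at most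
`A(2+2B) C · 4π (3ε)^γ/γ` (`holderMajorant`). Hence `∇v_ε → gradPotential` uniformly on
`B(x₀, ρ/2)`, and Mathlib's `hasFDerivAt_of_tendstoUniformlyOn` gives `HasFDerivAt v` there; the
limit is continuous as a uniform limit of continuous maps, so `v` is `C¹`.

## Contents (all proved)

* `suppCutoff x₀ ρ = radialCutoff ρ (2ρ) (· − x₀)`, `gradPotential K x₀ ρ f x` (the formula
  above as an element of `ℝ³ →L[ℝ] W`), `truncGrad K ε f x = ∫ (∇K_ε(x−y) ·)(f y) dy`;
* `continuous_truncGrad`, `truncGrad_eq` (the split), `integrable_gradIntegrand` (absolute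
  convergence of the singular first term), `norm_truncGrad_sub_gradPotential_le`;
* `hasFDerivAt_singularPotential`, `contDiff_singularPotential`, `fderiv_singularPotential`.

## References

* D. Gilbarg, N. S. Trudinger, *Elliptic PDE of Second Order* (2001), §4.1 Lemma 4.2, (4.9).
  [GilbargTrudinger2001]
* A. J. Majda, A. L. Bertozzi, *Vorticity and Incompressible Flow* (2002), §2.4.2 Prop. 2.17,
  §2.4.3 Prop. 2.20, §4.2 (4.49). [MajdaBertozziCUP2002]
-/

noncomputable section

open MeasureTheory Set Function Filter Metric Real
open _root_.Topology
open scoped ENNReal NNReal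

namespace Literature.Analysis.FluidPDE

/-- Local notation for physical space `ℝ³ = EuclideanSpace ℝ (Fin 3)`. -/
local notation "ℝ³" => EuclideanSpace ℝ (Fin 3)

variable {V W : Type*} [NormedAddCommGroup V] [NormedSpace ℝ V] [NormedAddCommGroup W]
  [NormedSpace ℝ W]

/-! ### The cutoff adapted to the support, the candidate gradient, the truncated gradient -/

/-- The cutoff `χ(y) = θ_ρ(y − x₀)`: smooth, `= 1` on `B̄(x₀, ρ)`, `= 0` off `B(x₀, 2ρ)`. [folklore] -/
def suppCutoff (x₀ : ℝ³) (ρ : ℝ) (y : ℝ³) : ℝ :=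
  radialCutoff ρ (2 * ρ) (y - x₀)

/-- The cutoff is smooth. [folklore] -/
theorem contDiff_suppCutoff (x₀ : ℝ³) (ρ : ℝ) {n : ℕ∞} : ContDiff ℝ n (suppCutoff x₀ ρ) :=
  (radialCutoff_contDiff (E' := ℝ³) ρ (2 * ρ)).comp (contDiff_id.sub contDiff_const)

/-- `χ = 1` on the closed ball `B̄(x₀, ρ)`. [folklore] -/
theorem suppCutoff_eq_one {x₀ : ℝ³} {ρ : ℝ} (hρ : 0 < ρ) {y : ℝ³} (hy : ‖y - x₀‖ ≤ ρ) :
    suppCutoff x₀ ρ y = 1 :=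
  radialCutoff_eq_one hρ.le (by linarith) hy

/-- `χ = 0` off the open ball `B(x₀, 2ρ)`. [folklore] -/
theorem suppCutoff_eq_zero {x₀ : ℝ³} {ρ : ℝ} (hρ : 0 < ρ) {y : ℝ³} (hy : 2 * ρ ≤ ‖y - x₀‖) :
    suppCutoff x₀ ρ y = 0 :=
  radialCutoff_eq_zero hρ.le (by linarith) hy

/-- `|χ| ≤ 1`. [folklore] -/
theorem abs_suppCutoff_le_one (x₀ : ℝ³) (ρ : ℝ) (y : ℝ³) : |suppCutoff x₀ ρ y| ≤ 1 :=
  abs_radialCutoff_le_one _ _ _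

/-- `χ` has compact support (inside `B̄(x₀, 2ρ)`). [folklore] -/
theorem hasCompactSupport_suppCutoff (x₀ : ℝ³) {ρ : ℝ} (hρ : 0 < ρ) :
    HasCompactSupport (suppCutoff x₀ ρ) := by
  refine HasCompactSupport.of_support_subset_isCompact (isCompact_closedBall x₀ (2 * ρ)) ?_
  intro y hy
  rw [mem_closedBall, dist_eq_norm]
  by_contra h
  exact hy (suppCutoff_eq_zero hρ (not_le.1 h).le)

/-- `∇χ = 0` on the open ball `B(x₀, ρ)` (where `χ ≡ 1`). [folklore] -/
theorem fderiv_suppCutoff_eq_zero {x₀ : ℝ³} {ρ : ℝ} (hρ : 0 < ρ) {y : ℝ³} (hy : ‖y - x₀‖ < ρ) :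
    fderiv ℝ (suppCutoff x₀ ρ) y = 0 := by
  have hev : suppCutoff x₀ ρ =ᶠ[𝓝 y] fun _ => 1 := by
    have : ball x₀ ρ ∈ 𝓝 y := isOpen_ball.mem_nhds (by rwa [mem_ball, dist_eq_norm])
    filter_upwards [this] with w hw
    rw [mem_ball, dist_eq_norm] at hw
    exact suppCutoff_eq_one hρ hw.le
  rw [hev.fderiv_eq]
  exact fderiv_const_apply (1 : ℝ)

/-- **The candidate gradient** (Gilbarg–Trudinger (4.9) with a smooth cutoff):
`gradPotential K x₀ ρ f x = ∫ (∇K(x−y) ·)(f y − χ(y) • f x) dy + ∫ (∇χ(y) ·) • K(x−y) f(x) dy`,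
as an element of `ℝ³ →L[ℝ] W`. Both integrals converge absolutely when `f` is Hölder with
support in `B̄(x₀, ρ)` and `x ∈ B(x₀, ρ/2)` (`integrable_gradIntegrand`). [cite: GilbargTrudinger2001, §4.1 Lemma 4.2 (4.9)] -/
def gradPotential (K : ℝ³ → V →L[ℝ] W) (x₀ : ℝ³) (ρ : ℝ) (f : ℝ³ → V) (x : ℝ³) : ℝ³ →L[ℝ] W :=
  (∫ y, (fderiv ℝ K (x - y)).flip (f y - suppCutoff x₀ ρ y • f x)) +
    ∫ y, (fderiv ℝ (suppCutoff x₀ ρ) y).smulRight (K (x - y) (f x))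

/-- **The gradient of the regularised potential**, `∇v_ε(x) = ∫ (∇K_ε(x−y) ·)(f y) dy`
(`hasFDerivAt_truncPotential`). [folklore] -/
def truncGrad (K : ℝ³ → V →L[ℝ] W) (ε : ℝ) (f : ℝ³ → V) (x : ℝ³) : ℝ³ →L[ℝ] W :=
  ∫ y, (fderiv ℝ (truncKernel K ε) (x - y)).flip (f y)

/-! ### Continuity and the split of the truncated gradient -/

section Truncated

variable {K : ℝ³ → V →L[ℝ] W} {A : ℝ}

/-- The integrand of `truncGrad` (and its variants with any continuous `g` in place of `f`) is
continuous in `y`. [folklore] -/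
theorem continuous_fderiv_truncKernel_flip_apply (hK : IsC1SingularKernel K A) {ε : ℝ} (hε : 0 < ε)
    {g : ℝ³ → V} (hg : Continuous g) (x : ℝ³) :
    Continuous fun y => (fderiv ℝ (truncKernel K ε) (x - y)).flip (g y) := by
  have hDc : Continuous (fderiv ℝ (truncKernel K ε)) :=
    (contDiff_truncKernel hK hε).continuous_fderiv one_ne_zero
  have h1 : Continuous fun y => (fderiv ℝ (truncKernel K ε) (x - y)).flip :=
    (ContinuousLinearMap.flipₗᵢ ℝ ℝ³ V W).continuous.comp (hDc.comp (continuous_const.sub continuous_id))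
  exact h1.clm_apply hg

/-- **`∇v_ε` is continuous** (dominated convergence: the integrand is jointly continuous and
dominated by `A(1+2B) ε⁻³ ‖f y‖`). [folklore] -/
theorem continuous_truncGrad (hK : IsC1SingularKernel K A) {ε : ℝ} (hε : 0 < ε) {f : ℝ³ → V}
    (hf : Continuous f) (hfc : HasCompactSupport f) : Continuous (truncGrad K ε f) := by
  obtain ⟨B, hB0, hB⟩ := exists_norm_fderiv_radialCutoff_le
  set C : ℝ := A * (1 + 2 * B) * (ε ^ 3)⁻¹
  have hDc : Continuous (fderiv ℝ (truncKernel K ε)) :=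
    (contDiff_truncKernel hK hε).continuous_fderiv one_ne_zero
  unfold truncGrad
  refine continuous_of_dominated (bound := fun y => C * ‖f y‖) ?_ ?_ ?_ ?_
  · exact fun x => (continuous_fderiv_truncKernel_flip_apply hK hε hf x).aestronglyMeasurable
  · refine fun x => Eventually.of_forall fun y => ?_
    calc ‖(fderiv ℝ (truncKernel K ε) (x - y)).flip (f y)‖
        ≤ ‖(fderiv ℝ (truncKernel K ε) (x - y)).flip‖ * ‖f y‖ := ContinuousLinearMap.le_opNorm _ _
      _ = ‖fderiv ℝ (truncKernel K ε) (x - y)‖ * ‖f y‖ := by rw [ContinuousLinearMap.opNorm_flip]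
      _ ≤ C * ‖f y‖ := by
          gcongr
          exact norm_fderiv_truncKernel_le_const hK hB0 hB hε (x - y)
  · have hb : HasCompactSupport (fun y => C * ‖f y‖) := hfc.norm.mul_left
    exact ((hf.norm).const_mul C).integrable_of_hasCompactSupport hb
  · refine Eventually.of_forall fun y => ?_
    have h1 : Continuous fun x : ℝ³ => (fderiv ℝ (truncKernel K ε) (x - y)).flip :=
      (ContinuousLinearMap.flipₗᵢ ℝ ℝ³ V W).continuous.comp (hDc.comp (continuous_id.sub continuous_const))
    exact h1.clm_apply continuous_const

/-- **Integration by parts in the cutoff term**: for fixed `x`, `v` and direction `e`,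
`∫ χ(y) • (∇K_ε(x − y) e) v dy = ∫ (∂ₑχ)(y) • K_ε(x − y) v dy` (the `x`-derivative of
`K_ε(x − y)` is minus its `y`-derivative; Mathlib
`integral_smul_fderiv_eq_neg_fderiv_smul_of_integrable`). [folklore] -/
theorem integral_suppCutoff_smul_fderiv_truncKernel (hK : IsC1SingularKernel K A) {ε : ℝ} (hε : 0 < ε)
    (x₀ : ℝ³) {ρ : ℝ} (hρ : 0 < ρ) (x : ℝ³) (v : V) (e : ℝ³) :
    ∫ y, suppCutoff x₀ ρ y • (fderiv ℝ (truncKernel K ε) (x - y) e) v =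
      ∫ y, (fderiv ℝ (suppCutoff x₀ ρ) y e) • (truncKernel K ε (x - y) v) := by
  -- `G(y) = K_ε(x − y) v` and its derivative
  have hKc : ContDiff ℝ 1 (truncKernel K ε) := contDiff_truncKernel hK hε
  have hGc : ContDiff ℝ 1 (fun y : ℝ³ => truncKernel K ε (x - y) v) :=
    (hKc.comp (contDiff_const.sub contDiff_id)).clm_apply contDiff_const
  have hGd : ∀ y, fderiv ℝ (fun y : ℝ³ => truncKernel K ε (x - y) v) y e =
      -((fderiv ℝ (truncKernel K ε) (x - y) e) v) := by
    intro y
    have h1 : HasFDerivAt (truncKernel K ε) (fderiv ℝ (truncKernel K ε) (x - y)) (x - y) :=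
      ((hKc.differentiable one_ne_zero) _).hasFDerivAt
    have h2 : HasFDerivAt (fun y : ℝ³ => x - y) (-(ContinuousLinearMap.id ℝ ℝ³)) y :=
      ((hasFDerivAt_const x y).sub (hasFDerivAt_id y)).congr_fderiv (by simp)
    have h3 : HasFDerivAt (fun y : ℝ³ => truncKernel K ε (x - y) v) _ y :=
      (h1.comp y h2).clm_apply (hasFDerivAt_const v y)
    rw [h3.fderiv]
    simp
  have hχc : ContDiff ℝ 1 (suppCutoff x₀ ρ) := contDiff_suppCutoff x₀ ρ
  have hχs : HasCompactSupport (suppCutoff x₀ ρ) := hasCompactSupport_suppCutoff x₀ hρ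
  -- integrability of the three products
  have i1 : Integrable fun y => fderiv ℝ (suppCutoff x₀ ρ) y e • truncKernel K ε (x - y) v :=
    (((hχc.continuous_fderiv one_ne_zero).clm_apply continuous_const).smul hGc.continuous)
      |>.integrable_of_hasCompactSupport ((hχs.fderiv_apply (𝕜 := ℝ) e).smul_right)
  have i2 : Integrable fun y => suppCutoff x₀ ρ y •
      fderiv ℝ (fun y : ℝ³ => truncKernel K ε (x - y) v) y e :=
    (hχc.continuous.smul ((hGc.continuous_fderiv one_ne_zero).clm_apply continuous_const))
      |>.integrable_of_hasCompactSupport hχs.smul_right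
  have i3 : Integrable fun y => suppCutoff x₀ ρ y • truncKernel K ε (x - y) v :=
    (hχc.continuous.smul hGc.continuous).integrable_of_hasCompactSupport hχs.smul_right
  -- integration by parts
  have key := integral_smul_fderiv_eq_neg_fderiv_smul_of_integrable (𝕜 := ℝ) (μ := volume)
    (f := suppCutoff x₀ ρ) (g := fun y : ℝ³ => truncKernel K ε (x - y) v) (v := e) i1 i2 i3
    (fun y _ => (hχc.differentiable one_ne_zero) y) (fun y _ => (hGc.differentiable one_ne_zero) y)
  have hl : ∫ y, suppCutoff x₀ ρ y • (fderiv ℝ (truncKernel K ε) (x - y) e) v =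
      -∫ y, suppCutoff x₀ ρ y • fderiv ℝ (fun y : ℝ³ => truncKernel K ε (x - y) v) y e := by
    rw [← integral_neg]
    refine integral_congr_ae (Eventually.of_forall fun y => ?_)
    simp only [hGd, smul_neg, neg_neg]
  rw [hl, key, neg_neg]

/-- **The split of the truncated gradient**:
`∇v_ε(x) = ∫ (∇K_ε(x−y) ·)(f y − χ y • f x) dy + ∫ (∇χ(y) ·) • K_ε(x−y) f(x) dy`
(linearity in the density and `integral_suppCutoff_smul_fderiv_truncKernel`). [folklore] -/
theorem truncGrad_eq (hK : IsC1SingularKernel K A) {ε : ℝ} (hε : 0 < ε) (x₀ : ℝ³) {ρ : ℝ} (hρ : 0 < ρ)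
    {f : ℝ³ → V} (hf : Continuous f) (hfc : HasCompactSupport f) (x : ℝ³) :
    truncGrad K ε f x =
      (∫ y, (fderiv ℝ (truncKernel K ε) (x - y)).flip (f y - suppCutoff x₀ ρ y • f x)) +
        ∫ y, (fderiv ℝ (suppCutoff x₀ ρ) y).smulRight (truncKernel K ε (x - y) (f x)) := by
  have hχc : ContDiff ℝ 1 (suppCutoff x₀ ρ) := contDiff_suppCutoff x₀ ρ
  have hχs : HasCompactSupport (suppCutoff x₀ ρ) := hasCompactSupport_suppCutoff x₀ hρ
  have hKc : ContDiff ℝ 1 (truncKernel K ε) := contDiff_truncKernel hK hε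
  -- the three integrands and their integrability
  have hg : Continuous fun y => f y - suppCutoff x₀ ρ y • f x := hf.sub (hχc.continuous.smul continuous_const)
  have hgc : HasCompactSupport fun y => f y - suppCutoff x₀ ρ y • f x := hfc.sub hχs.smul_right
  have i_f : Integrable fun y => (fderiv ℝ (truncKernel K ε) (x - y)).flip (f y) :=
    (continuous_fderiv_truncKernel_flip_apply hK hε hf x).integrable_of_hasCompactSupport
      (hfc.mono fun y hy => by
        rw [mem_support] at hy ⊢
        intro h0
        exact hy (by rw [h0, map_zero]))
  have i_g : Integrable fun y => (fderiv ℝ (truncKernel K ε) (x - y)).flip (f y - suppCutoff x₀ ρ y • f x) :=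
    (continuous_fderiv_truncKernel_flip_apply hK hε hg x).integrable_of_hasCompactSupport
      (hgc.mono fun y hy => by
        rw [mem_support] at hy ⊢
        intro h0
        exact hy (by rw [h0, map_zero]))
  have hcχ : Continuous fun y => suppCutoff x₀ ρ y • f x := hχc.continuous.smul continuous_const
  have hcs : HasCompactSupport (fun y => suppCutoff x₀ ρ y • f x) := hχs.smul_right
  have i_χ : Integrable fun y => (fderiv ℝ (truncKernel K ε) (x - y)).flip (suppCutoff x₀ ρ y • f x) :=
    (continuous_fderiv_truncKernel_flip_apply hK hε hcχ x).integrable_of_hasCompactSupport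
      (hcs.mono fun y hy => by
        rw [mem_support] at hy ⊢
        intro h0
        exact hy (by rw [h0, map_zero]))
  have hsc : Continuous fun y => (fderiv ℝ (suppCutoff x₀ ρ) y).smulRight (truncKernel K ε (x - y) (f x)) := by
    have h1 : Continuous fun y => ContinuousLinearMap.smulRightL ℝ ℝ³ W (fderiv ℝ (suppCutoff x₀ ρ) y)
        (truncKernel K ε (x - y) (f x)) :=
      ((ContinuousLinearMap.smulRightL ℝ ℝ³ W).continuous.comp (hχc.continuous_fderiv one_ne_zero)).clm_apply
        ((hKc.continuous.comp (continuous_const.sub continuous_id)).clm_apply continuous_const)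
    exact h1
  have i_s : Integrable fun y => (fderiv ℝ (suppCutoff x₀ ρ) y).smulRight (truncKernel K ε (x - y) (f x)) :=
    hsc.integrable_of_hasCompactSupport ((hχs.fderiv (𝕜 := ℝ)).mono fun y hy => by
      rw [mem_support] at hy ⊢
      intro h0
      exact hy (by rw [h0, ContinuousLinearMap.zero_smulRight]))
  -- split the density `f y = (f y - χ y • f x) + χ y • f x`
  have hsplit : truncGrad K ε f x =
      (∫ y, (fderiv ℝ (truncKernel K ε) (x - y)).flip (f y - suppCutoff x₀ ρ y • f x)) +
        ∫ y, (fderiv ℝ (truncKernel K ε) (x - y)).flip (suppCutoff x₀ ρ y • f x) := by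
    rw [truncGrad, ← integral_add i_g i_χ]
    refine integral_congr_ae (Eventually.of_forall fun y => ?_)
    simp only
    rw [← map_add, sub_add_cancel]
  rw [hsplit]
  congr 1
  -- the cutoff term: pull out the direction and integrate by parts
  ext e
  rw [ContinuousLinearMap.integral_apply i_χ, ContinuousLinearMap.integral_apply i_s]
  simp only [ContinuousLinearMap.flip_apply, ContinuousLinearMap.smulRight_apply, map_smul,
    smul_apply]
  exact integral_suppCutoff_smul_fderiv_truncKernel hK hε x₀ hρ x (f x) e

/-- **For small `ε` the cutoff term is already at its limit**: if `x ∈ B(x₀, ρ/2)` and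
`ε ≤ ρ/4`, then `∫ (∇χ(y) ·) • K_ε(x−y) f(x) dy = ∫ (∇χ(y) ·) • K(x−y) f(x) dy` (where `∇χ(y) ≠ 0`
one has `|y − x₀| ≥ ρ`, hence `|x − y| ≥ ρ/2 ≥ 2ε` and `K_ε = K`). [folklore] -/
theorem integral_cutoffTerm_truncKernel_eq (K : ℝ³ → V →L[ℝ] W) {ε ρ : ℝ} (hε : 0 < ε) (hρ : 0 < ρ)
    (hερ : ε ≤ ρ / 4) (x₀ : ℝ³) {x : ℝ³} (hx : ‖x - x₀‖ < ρ / 2) (v : V) :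
    ∫ y, (fderiv ℝ (suppCutoff x₀ ρ) y).smulRight (truncKernel K ε (x - y) v) =
      ∫ y, (fderiv ℝ (suppCutoff x₀ ρ) y).smulRight (K (x - y) v) := by
  refine integral_congr_ae (Eventually.of_forall fun y => ?_)
  by_cases hy : ‖y - x₀‖ < ρ
  · simp only [fderiv_suppCutoff_eq_zero hρ hy, ContinuousLinearMap.zero_smulRight]
  · have h1 : 2 * ε ≤ ‖x - y‖ := by
      have : ‖y - x₀‖ ≤ ‖y - x‖ + ‖x - x₀‖ := norm_sub_le_norm_sub_add_norm_sub _ _ _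
      rw [norm_sub_rev y x] at this
      linarith [not_lt.1 hy]
    simp only [truncKernel_eq K hε h1]

end Truncated

/-! ### The singular first term: pointwise bounds and absolute convergence -/

section Singular

variable {K : ℝ³ → V →L[ℝ] W} {A : ℝ}

/-- `|x − y|^γ · (|x − y|³)⁻¹ = |x − y|^{γ−3}` for `x ≠ y`. [folklore] -/
theorem rpow_mul_inv_pow_three {t : ℝ} (ht : 0 < t) (γ : ℝ) : t ^ γ * (t ^ 3)⁻¹ = t ^ (γ - 3) := by
  rw [Real.rpow_sub ht, show (3 : ℝ) = ((3 : ℕ) : ℝ) by norm_num, Real.rpow_natCast, div_eq_mul_inv]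

/-- **Pointwise bound for the singular gradient integrand near the diagonal**: if `f` is
`γ`-Hölder with constant `C`, `x ≠ y`, and `‖D‖ ≤ A' |x − y|⁻³`, then
`‖(D ·)(f y − f x)‖ ≤ A' C |x − y|^{γ−3}` (used with `D = ∇K(x−y)`, and with
`D = ∇K_ε(x−y) − ∇K(x−y)` through the sum of the two derivative bounds). [folklore] -/
theorem norm_flip_apply_sub_le_of_holderWith {D : ℝ³ →L[ℝ] V →L[ℝ] W} {A' : ℝ} {x y : ℝ³}
    (hxy : x ≠ y) (hD : ‖D‖ ≤ A' * (‖x - y‖ ^ 3)⁻¹) {γ C : ℝ≥0} {f : ℝ³ → V}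
    (hf : HolderWith C γ f) :
    ‖D.flip (f y - f x)‖ ≤ A' * C * ‖x - y‖ ^ ((γ : ℝ) - 3) := by
  have hpos : 0 < ‖x - y‖ := norm_pos_iff.2 (sub_ne_zero.2 hxy)
  have hA' : 0 ≤ A' * (‖x - y‖ ^ 3)⁻¹ := (norm_nonneg D).trans hD
  have hg : ‖f y - f x‖ ≤ C * ‖x - y‖ ^ (γ : ℝ) := by
    rw [← dist_eq_norm, norm_sub_rev, ← dist_eq_norm]
    exact hf.dist_le y x
  calc ‖D.flip (f y - f x)‖ ≤ ‖D.flip‖ * ‖f y - f x‖ := ContinuousLinearMap.le_opNorm _ _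
    _ = ‖D‖ * ‖f y - f x‖ := by rw [ContinuousLinearMap.opNorm_flip]
    _ ≤ A' * (‖x - y‖ ^ 3)⁻¹ * (C * ‖x - y‖ ^ (γ : ℝ)) := by gcongr
    _ = A' * C * (‖x - y‖ ^ (γ : ℝ) * (‖x - y‖ ^ 3)⁻¹) := by ring
    _ = A' * C * ‖x - y‖ ^ ((γ : ℝ) - 3) := by rw [rpow_mul_inv_pow_three hpos]

/-- **Pointwise domination of the singular gradient integrand** `(∇K(x−y) ·)(f y − χ y • f x)` for
`x ∈ B(x₀, ρ/2)`, `supp f ⊆ B̄(x₀, ρ)`, `|f| ≤ M`, `f` `γ`-Hölder with constant `C`: by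
`A C 1_{|x−y|<2ρ} |x − y|^{γ−3} + 8 A M ρ⁻³ 1_{B̄(x₀,2ρ)}(y)` (near the support `χ = 1` and the
Hölder bound applies; on the shell `ρ < |y − x₀| < 2ρ` the density vanishes, `|x − y| > ρ/2`,
and `‖χ y • f x‖ ≤ M`; beyond `2ρ` everything vanishes). [folklore] -/
theorem norm_gradIntegrand_le (hK : IsC1SingularKernel K A) {γ C : ℝ≥0} {f : ℝ³ → V}
    (hf : HolderWith C γ f) {x₀ : ℝ³} {ρ M : ℝ} (hρ : 0 < ρ) (hsupp : tsupport f ⊆ closedBall x₀ ρ)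
    (hM : ∀ y, ‖f y‖ ≤ M) {x : ℝ³} (hx : ‖x - x₀‖ < ρ / 2) (y : ℝ³) :
    ‖(fderiv ℝ K (x - y)).flip (f y - suppCutoff x₀ ρ y • f x)‖ ≤
      A * C * holderMajorant γ (2 * ρ) (x - y) +
        8 * A * M * (ρ ^ 3)⁻¹ * (closedBall x₀ (2 * ρ)).indicator (fun _ => (1 : ℝ)) y := by
  have hA := hK.nonneg
  have hM0 : 0 ≤ M := (norm_nonneg _).trans (hM x)
  have hterm2 : 0 ≤ 8 * A * M * (ρ ^ 3)⁻¹ * (closedBall x₀ (2 * ρ)).indicator (fun _ => (1 : ℝ)) y :=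
    mul_nonneg (by positivity) (indicator_nonneg (fun _ _ => zero_le_one) _)
  have hterm1 : 0 ≤ A * C * holderMajorant γ (2 * ρ) (x - y) :=
    mul_nonneg (by positivity) (holderMajorant_nonneg _ _ _)
  by_cases hy : ‖y - x₀‖ ≤ ρ
  · -- near the support: `χ y = 1`, Hölder bound
    rw [suppCutoff_eq_one hρ hy, one_smul]
    rcases eq_or_ne x y with hxy | hxy
    · subst hxy
      simp only [sub_self, map_zero, norm_zero]
      exact add_nonneg (mul_nonneg (by positivity) (holderMajorant_nonneg _ _ _)) hterm2
    · have h := norm_flip_apply_sub_le_of_holderWith hxy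
        (hK.norm_fderiv_le _ (sub_ne_zero.2 hxy)) hf
      refine h.trans (le_add_of_le_of_nonneg ?_ hterm2)
      have hxy2 : ‖x - y‖ < 2 * ρ := by
        have : ‖x - y‖ ≤ ‖x - x₀‖ + ‖x₀ - y‖ := norm_sub_le_norm_sub_add_norm_sub _ _ _
        rw [norm_sub_rev x₀ y] at this
        linarith
      have hmaj : holderMajorant γ (2 * ρ) (x - y) = ‖x - y‖ ^ ((γ : ℝ) - 3) := by
        simp [holderMajorant, indicator, hxy2]
      rw [hmaj]
  · by_cases hy2 : ‖y - x₀‖ < 2 * ρ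
    · -- the shell: `f y = 0`, `|x - y| > ρ / 2`
      have hfy : f y = 0 := by
        have : y ∉ tsupport f := fun h => hy (by
          have := hsupp h
          rwa [mem_closedBall, dist_eq_norm] at this)
        exact image_eq_zero_of_notMem_tsupport this
      have hxy : ρ / 2 < ‖x - y‖ := by
        have : ‖y - x₀‖ ≤ ‖y - x‖ + ‖x - x₀‖ := norm_sub_le_norm_sub_add_norm_sub _ _ _
        rw [norm_sub_rev y x] at this
        linarith [not_le.1 hy]
      have hxy0 : x - y ≠ 0 := by
        intro h
        rw [h, norm_zero] at hxy
        linarith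
      have hind : (closedBall x₀ (2 * ρ)).indicator (fun _ => (1 : ℝ)) y = 1 := by
        rw [indicator_of_mem]
        rw [mem_closedBall, dist_eq_norm]
        exact hy2.le
      rw [hind, mul_one, hfy, zero_sub, map_neg, norm_neg, map_smul, norm_smul, Real.norm_eq_abs]
      refine le_add_of_nonneg_of_le hterm1 ?_
      have hD : ‖fderiv ℝ K (x - y)‖ ≤ 8 * A * (ρ ^ 3)⁻¹ := by
        refine (hK.norm_fderiv_le _ hxy0).trans ?_
        have h8 : (‖x - y‖ ^ 3)⁻¹ ≤ 8 * (ρ ^ 3)⁻¹ := by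
          have hρ2 : (ρ / 2) ^ 3 ≤ ‖x - y‖ ^ 3 := pow_le_pow_left₀ (by positivity) hxy.le 3
          calc (‖x - y‖ ^ 3)⁻¹ ≤ ((ρ / 2) ^ 3)⁻¹ := inv_anti₀ (by positivity) hρ2
            _ = 8 * (ρ ^ 3)⁻¹ := by field_simp; norm_num
        calc A * (‖x - y‖ ^ 3)⁻¹ ≤ A * (8 * (ρ ^ 3)⁻¹) := by gcongr
          _ = 8 * A * (ρ ^ 3)⁻¹ := by ring
      calc |suppCutoff x₀ ρ y| * ‖(fderiv ℝ K (x - y)).flip (f x)‖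
          ≤ 1 * (‖(fderiv ℝ K (x - y)).flip‖ * ‖f x‖) := by
            gcongr
            · exact abs_suppCutoff_le_one _ _ _
            · exact ContinuousLinearMap.le_opNorm _ _
        _ = ‖fderiv ℝ K (x - y)‖ * ‖f x‖ := by rw [one_mul, ContinuousLinearMap.opNorm_flip]
        _ ≤ 8 * A * (ρ ^ 3)⁻¹ * M := by gcongr; exact hM x
        _ = 8 * A * M * (ρ ^ 3)⁻¹ := by ring
    · -- beyond `2ρ`: everything vanishes
      have hfy : f y = 0 := by
        have : y ∉ tsupport f := fun h => hy (by
          have := hsupp h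
          rwa [mem_closedBall, dist_eq_norm] at this)
        exact image_eq_zero_of_notMem_tsupport this
      rw [hfy, suppCutoff_eq_zero hρ (not_lt.1 hy2), zero_smul, sub_zero, map_zero, norm_zero]
      exact add_nonneg hterm1 hterm2

/-- The derivative of a singular kernel is continuous away from the origin. [folklore] -/
theorem IsC1SingularKernel.continuousOn_fderiv (hK : IsC1SingularKernel K A) :
    ContinuousOn (fderiv ℝ K) {0}ᶜ := fun z hz =>
  ((hK.contDiffAt z hz).continuousAt_fderiv one_ne_zero).continuousWithinAt

/-- The singular gradient integrand `y ↦ (∇K(x−y) ·)(g y)` is a.e. strongly measurable for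
continuous `g` (continuous off the null set `{x}`). [folklore] -/
theorem aestronglyMeasurable_fderiv_flip_apply (hK : IsC1SingularKernel K A) {g : ℝ³ → V}
    (hg : Continuous g) (x : ℝ³) :
    AEStronglyMeasurable (fun y => (fderiv ℝ K (x - y)).flip (g y)) volume := by
  have hcont : ContinuousOn (fun y => (fderiv ℝ K (x - y)).flip (g y)) {x}ᶜ := by
    refine ContinuousOn.clm_apply ?_ hg.continuousOn
    refine (ContinuousLinearMap.flipₗᵢ ℝ ℝ³ V W).continuous.comp_continuousOn ?_
    refine hK.continuousOn_fderiv.comp (continuous_const.sub continuous_id).continuousOn fun y hy => ?_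
    simp only [mem_compl_iff, mem_singleton_iff] at hy ⊢
    exact sub_ne_zero.2 (Ne.symm hy)
  have h := hcont.aestronglyMeasurable (μ := volume) (measurableSet_singleton x).compl
  rwa [restrict_compl_singleton] at h

/-- **Absolute convergence of the singular first term of the gradient**: for `x ∈ B(x₀, ρ/2)`,
`supp f ⊆ B̄(x₀, ρ)`, `f` `γ`-Hölder with `0 < γ`, the integrand `(∇K(x−y) ·)(f y − χ y • f x)`
is integrable (domination `norm_gradIntegrand_le` by the integrable
`A C · holderMajorant + const · 1_{B̄(x₀,2ρ)}`). [folklore] -/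
theorem integrable_gradIntegrand (hK : IsC1SingularKernel K A) {γ C : ℝ≥0} (hγ : 0 < γ) {f : ℝ³ → V}
    (hf : HolderWith C γ f) {x₀ : ℝ³} {ρ : ℝ} (hρ : 0 < ρ) (hsupp : tsupport f ⊆ closedBall x₀ ρ)
    {x : ℝ³} (hx : ‖x - x₀‖ < ρ / 2) :
    Integrable fun y => (fderiv ℝ K (x - y)).flip (f y - suppCutoff x₀ ρ y • f x) := by
  have hfc : HasCompactSupport f :=
    HasCompactSupport.of_support_subset_isCompact (isCompact_closedBall x₀ ρ)
      ((subset_tsupport f).trans hsupp)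
  have hfcont : Continuous f := hf.continuous hγ
  obtain ⟨M, hM⟩ := hfcont.bounded_above_of_compact_support hfc
  have hg : Continuous fun y => f y - suppCutoff x₀ ρ y • f x :=
    hfcont.sub ((contDiff_suppCutoff x₀ ρ (n := 0)).continuous.smul continuous_const)
  refine Integrable.mono' ?_ (aestronglyMeasurable_fderiv_flip_apply hK hg x)
    (Eventually.of_forall fun y => norm_gradIntegrand_le hK hf hρ hsupp hM hx y)
  refine Integrable.add ?_ ?_
  · exact ((integrable_holderMajorant (by exact_mod_cast hγ) (2 * ρ)).comp_sub_left x).const_mul _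
  · refine Integrable.const_mul ?_ _
    rw [integrable_indicator_iff measurableSet_closedBall]
    exact continuousOn_const.integrableOn_compact (isCompact_closedBall x₀ (2 * ρ))

/-- **The singular first term is the limit of its truncations, quantitatively**: for
`x ∈ B(x₀, ρ/2)`, `0 < ε ≤ ρ/4`, with the cutoff-derivative constant `B`,
`‖∫ (∇K_ε(x−y) ·)(g y) dy − ∫ (∇K(x−y) ·)(g y) dy‖ ≤ A(2+2B) C · 4π (3ε)^γ/γ`,
`g y = f y − χ y • f x` (the integrands differ only on `|x − y| ≤ 2ε`, where `χ = 1` and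
`‖(∇K_ε − ∇K)(x−y)‖ ‖f y − f x‖ ≤ A(2+2B) |x−y|⁻³ · C |x−y|^γ`; Gilbarg–Trudinger, proof of
Lemma 4.2, the estimate of `|D_{ij} w_ε − u_{ij}|`). [folklore] -/
theorem norm_integral_truncGradIntegrand_sub_le (hK : IsC1SingularKernel K A) {B : ℝ} (hB0 : 0 ≤ B)
    (hB : ∀ ε : ℝ, 0 < ε → ∀ z : ℝ³, ‖fderiv ℝ (radialCutoff ε (2 * ε)) z‖ ≤ B * ε⁻¹)
    {γ C : ℝ≥0} (hγ : 0 < γ) {f : ℝ³ → V} (hf : HolderWith C γ f) {x₀ : ℝ³} {ρ : ℝ} (hρ : 0 < ρ)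
    (hsupp : tsupport f ⊆ closedBall x₀ ρ) {x : ℝ³} (hx : ‖x - x₀‖ < ρ / 2) {ε : ℝ} (hε : 0 < ε)
    (hερ : ε ≤ ρ / 4) :
    ‖(∫ y, (fderiv ℝ (truncKernel K ε) (x - y)).flip (f y - suppCutoff x₀ ρ y • f x)) -
        ∫ y, (fderiv ℝ K (x - y)).flip (f y - suppCutoff x₀ ρ y • f x)‖ ≤
      A * (2 + 2 * B) * C * (4 * π * (3 * ε) ^ (γ : ℝ) / γ) := by
  have hA := hK.nonneg
  have hfc : HasCompactSupport f :=
    HasCompactSupport.of_support_subset_isCompact (isCompact_closedBall x₀ ρ)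
      ((subset_tsupport f).trans hsupp)
  have hfcont : Continuous f := hf.continuous hγ
  have hχc : ContDiff ℝ 1 (suppCutoff x₀ ρ) := contDiff_suppCutoff x₀ ρ
  have hχs : HasCompactSupport (suppCutoff x₀ ρ) := hasCompactSupport_suppCutoff x₀ hρ
  have hg : Continuous fun y => f y - suppCutoff x₀ ρ y • f x :=
    hfcont.sub (hχc.continuous.smul continuous_const)
  have hgc : HasCompactSupport fun y => f y - suppCutoff x₀ ρ y • f x := hfc.sub hχs.smul_right
  have i₁ : Integrable fun y => (fderiv ℝ (truncKernel K ε) (x - y)).flip (f y - suppCutoff x₀ ρ y • f x) :=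
    (continuous_fderiv_truncKernel_flip_apply hK hε hg x).integrable_of_hasCompactSupport
      (hgc.mono fun y hy => by
        rw [mem_support] at hy ⊢
        intro h0
        exact hy (by rw [h0, map_zero]))
  have i₂ := integrable_gradIntegrand hK hγ hf hρ hsupp hx
  rw [← integral_sub i₁ i₂]
  -- pointwise domination of the difference
  set c : ℝ := A * (2 + 2 * B) * C with hc
  have hc0 : 0 ≤ c := by positivity
  have hpt : ∀ y, ‖(fderiv ℝ (truncKernel K ε) (x - y)).flip (f y - suppCutoff x₀ ρ y • f x) -
      (fderiv ℝ K (x - y)).flip (f y - suppCutoff x₀ ρ y • f x)‖ ≤ c * holderMajorant γ (3 * ε) (x - y) := by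
    intro y
    by_cases hfar : 2 * ε < ‖x - y‖
    · -- the kernels agree near `x - y`, so do their derivatives
      have hev : truncKernel K ε =ᶠ[𝓝 (x - y)] K := by
        have : {z : ℝ³ | 2 * ε < ‖z‖} ∈ 𝓝 (x - y) :=
          (isOpen_lt continuous_const continuous_norm).mem_nhds hfar
        filter_upwards [this] with z hz
        exact truncKernel_eq K hε (le_of_lt hz)
      rw [hev.fderiv_eq, sub_self, norm_zero]
      exact mul_nonneg hc0 (holderMajorant_nonneg _ _ _)
    · have hnear : ‖x - y‖ ≤ 2 * ε := not_lt.1 hfar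
      -- `y` is close to `x`, inside the ball where `χ = 1`
      have hyρ : ‖y - x₀‖ ≤ ρ := by
        have : ‖y - x₀‖ ≤ ‖y - x‖ + ‖x - x₀‖ := norm_sub_le_norm_sub_add_norm_sub _ _ _
        rw [norm_sub_rev y x] at this
        linarith
      rw [suppCutoff_eq_one hρ hyρ, one_smul]
      rcases eq_or_ne x y with hxy | hxy
      · subst hxy
        simp only [sub_self, map_zero, norm_zero]
        exact mul_nonneg hc0 (holderMajorant_nonneg _ _ _)
      · have hxy0 : x - y ≠ 0 := sub_ne_zero.2 hxy
        have h₁ := norm_flip_apply_sub_le_of_holderWith hxy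
          (norm_fderiv_truncKernel_le hK hB0 hB hε hxy0) hf
        have h₂ := norm_flip_apply_sub_le_of_holderWith hxy (hK.norm_fderiv_le _ hxy0) hf
        have hxy3 : ‖x - y‖ < 3 * ε := by linarith
        have hmaj : holderMajorant γ (3 * ε) (x - y) = ‖x - y‖ ^ ((γ : ℝ) - 3) := by
          simp [holderMajorant, indicator, hxy3]
        calc ‖(fderiv ℝ (truncKernel K ε) (x - y)).flip (f y - f x) -
              (fderiv ℝ K (x - y)).flip (f y - f x)‖
            ≤ ‖(fderiv ℝ (truncKernel K ε) (x - y)).flip (f y - f x)‖ +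
                ‖(fderiv ℝ K (x - y)).flip (f y - f x)‖ := norm_sub_le _ _
          _ ≤ A * (1 + 2 * B) * C * ‖x - y‖ ^ ((γ : ℝ) - 3) + A * C * ‖x - y‖ ^ ((γ : ℝ) - 3) :=
              add_le_add h₁ h₂
          _ = c * holderMajorant γ (3 * ε) (x - y) := by rw [hmaj, hc]; ring
  -- integrate the domination
  have h1 : ‖∫ y, ((fderiv ℝ (truncKernel K ε) (x - y)).flip (f y - suppCutoff x₀ ρ y • f x) -
      (fderiv ℝ K (x - y)).flip (f y - suppCutoff x₀ ρ y • f x))‖ₑ ≤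
      ENNReal.ofReal (c * (4 * π * (3 * ε) ^ (γ : ℝ) / γ)) := by
    refine (enorm_integral_le_lintegral_enorm _).trans ?_
    have h2 := lintegral_mono (μ := (volume : Measure ℝ³)) fun y =>
      (show ‖(fderiv ℝ (truncKernel K ε) (x - y)).flip (f y - suppCutoff x₀ ρ y • f x) -
          (fderiv ℝ K (x - y)).flip (f y - suppCutoff x₀ ρ y • f x)‖ₑ ≤
          ENNReal.ofReal c * ENNReal.ofReal (holderMajorant γ (3 * ε) (x - y)) from by
        rw [← ofReal_norm, ← ENNReal.ofReal_mul hc0]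
        exact ENNReal.ofReal_le_ofReal (hpt y))
    refine h2.trans ?_
    have hmk : Measurable fun y : ℝ³ => ENNReal.ofReal (holderMajorant γ (3 * ε) (x - y)) :=
      ((measurable_holderMajorant γ (3 * ε)).comp (measurable_const.sub measurable_id)).ennreal_ofReal
    rw [lintegral_const_mul _ hmk,
      lintegral_sub_left_eq_self (μ := (volume : Measure ℝ³))
        (fun z => ENNReal.ofReal (holderMajorant γ (3 * ε) z)) x,
      lintegral_holderMajorant (by exact_mod_cast hγ) (by positivity), ← ENNReal.ofReal_mul hc0]
  rw [← ofReal_norm] at h1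
  exact (ENNReal.ofReal_le_ofReal_iff (by positivity)).1 h1

end Singular

/-! ### Uniform convergence of the truncated gradients and the main theorems -/

section Main

variable {K : ℝ³ → V →L[ℝ] W} {A : ℝ}

/-- **`∇v_ε → gradPotential` at rate `ε^γ`, uniformly on `B(x₀, ρ/2)`**: for `0 < ε ≤ ρ/4` and
`x ∈ B(x₀, ρ/2)`, `‖∇v_ε(x) − gradPotential(x)‖ ≤ A(2+2B) C · 4π (3ε)^γ/γ` (split
`truncGrad_eq`, the cutoff terms agree, `integral_cutoffTerm_truncKernel_eq`, and the singular
terms differ by `norm_integral_truncGradIntegrand_sub_le`). [folklore] -/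
theorem norm_truncGrad_sub_gradPotential_le (hK : IsC1SingularKernel K A) {B : ℝ} (hB0 : 0 ≤ B)
    (hB : ∀ ε : ℝ, 0 < ε → ∀ z : ℝ³, ‖fderiv ℝ (radialCutoff ε (2 * ε)) z‖ ≤ B * ε⁻¹)
    {γ C : ℝ≥0} (hγ : 0 < γ) {f : ℝ³ → V} (hf : HolderWith C γ f) {x₀ : ℝ³} {ρ : ℝ} (hρ : 0 < ρ)
    (hsupp : tsupport f ⊆ closedBall x₀ ρ) {x : ℝ³} (hx : ‖x - x₀‖ < ρ / 2) {ε : ℝ} (hε : 0 < ε)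
    (hερ : ε ≤ ρ / 4) :
    ‖truncGrad K ε f x - gradPotential K x₀ ρ f x‖ ≤
      A * (2 + 2 * B) * C * (4 * π * (3 * ε) ^ (γ : ℝ) / γ) := by
  have hfc : HasCompactSupport f :=
    HasCompactSupport.of_support_subset_isCompact (isCompact_closedBall x₀ ρ)
      ((subset_tsupport f).trans hsupp)
  have hfcont : Continuous f := hf.continuous hγ
  rw [truncGrad_eq hK hε x₀ hρ hfcont hfc x, gradPotential,
    integral_cutoffTerm_truncKernel_eq K hε hρ hερ x₀ hx (f x), add_sub_add_right_eq_sub]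
  exact norm_integral_truncGradIntegrand_sub_le hK hB0 hB hγ hf hρ hsupp hx hε hερ

/-- The truncation scales `ε_n = ρ/(4(n+1))`: positive, at most `ρ/4`, tending to `0`. [folklore] -/
theorem epsSeq_pos {ρ : ℝ} (hρ : 0 < ρ) (n : ℕ) : 0 < ρ / 4 / ((n : ℝ) + 1) := by positivity

/-- `ε_n ≤ ρ/4`. [folklore] -/
theorem epsSeq_le {ρ : ℝ} (hρ : 0 < ρ) (n : ℕ) : ρ / 4 / ((n : ℝ) + 1) ≤ ρ / 4 :=
  div_le_self (by positivity) (by linarith [n.cast_nonneg (α := ℝ)])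

/-- `ε_n → 0`. [folklore] -/
theorem tendsto_epsSeq (ρ : ℝ) : Tendsto (fun n : ℕ => ρ / 4 / ((n : ℝ) + 1)) atTop (𝓝 0) := by
  have h := (tendsto_one_div_add_atTop_nhds_zero_nat (𝕜 := ℝ)).const_mul (ρ / 4)
  rw [mul_zero] at h
  refine h.congr fun n => ?_
  rw [mul_one_div]

/-- **Uniform convergence of the truncated gradients** along `ε_n = ρ/(4(n+1))` on the ball
`B(x₀, ρ/2)` (from `norm_truncGrad_sub_gradPotential_le` and `(3ε_n)^γ → 0`). [folklore] -/
theorem tendstoUniformlyOn_truncGrad (hK : IsC1SingularKernel K A) {γ C : ℝ≥0} (hγ : 0 < γ)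
    {f : ℝ³ → V} (hf : HolderWith C γ f) {x₀ : ℝ³} {ρ : ℝ} (hρ : 0 < ρ)
    (hsupp : tsupport f ⊆ closedBall x₀ ρ) :
    TendstoUniformlyOn (fun n : ℕ => truncGrad K (ρ / 4 / ((n : ℝ) + 1)) f)
      (gradPotential K x₀ ρ f) atTop (ball x₀ (ρ / 2)) := by
  obtain ⟨B, hB0, hB⟩ := exists_norm_fderiv_radialCutoff_le
  set b : ℕ → ℝ := fun n => A * (2 + 2 * B) * C * (4 * π * (3 * (ρ / 4 / ((n : ℝ) + 1))) ^ (γ : ℝ) / γ)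
  have hb : Tendsto b atTop (𝓝 0) := by
    have h3 : Tendsto (fun n : ℕ => 3 * (ρ / 4 / ((n : ℝ) + 1))) atTop (𝓝 0) := by
      simpa using (tendsto_epsSeq ρ).const_mul 3
    have hpow : Tendsto (fun n : ℕ => (3 * (ρ / 4 / ((n : ℝ) + 1))) ^ (γ : ℝ)) atTop (𝓝 0) := by
      have hc := (Real.continuousAt_rpow_const 0 (γ : ℝ) (Or.inr (by exact_mod_cast hγ.le))).tendsto
      rw [Real.zero_rpow (by exact_mod_cast hγ.ne')] at hc
      exact hc.comp h3
    have : Tendsto (fun n : ℕ => A * (2 + 2 * B) * C * (4 * π * (3 * (ρ / 4 / ((n : ℝ) + 1))) ^ (γ : ℝ) / γ))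
        atTop (𝓝 (A * (2 + 2 * B) * C * (4 * π * 0 / γ))) :=
      ((hpow.const_mul (4 * π)).div_const _).const_mul _
    simpa using this
  rw [Metric.tendstoUniformlyOn_iff]
  intro δ hδ
  filter_upwards [hb.eventually (gt_mem_nhds hδ)] with n hn x hx
  rw [mem_ball_iff_norm] at hx
  rw [dist_comm, dist_eq_norm]
  exact (norm_truncGrad_sub_gradPotential_le hK hB0 hB hγ hf hρ hsupp hx (epsSeq_pos hρ n)
    (epsSeq_le hρ n)).trans_lt hn

/-- **The candidate gradient is continuous on `B(x₀, ρ/2)`** (uniform limit of the continuous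
truncated gradients). [folklore] -/
theorem continuousOn_gradPotential (hK : IsC1SingularKernel K A) {γ C : ℝ≥0} (hγ : 0 < γ)
    {f : ℝ³ → V} (hf : HolderWith C γ f) {x₀ : ℝ³} {ρ : ℝ} (hρ : 0 < ρ)
    (hsupp : tsupport f ⊆ closedBall x₀ ρ) :
    ContinuousOn (gradPotential K x₀ ρ f) (ball x₀ (ρ / 2)) := by
  have hfc : HasCompactSupport f :=
    HasCompactSupport.of_support_subset_isCompact (isCompact_closedBall x₀ ρ)
      ((subset_tsupport f).trans hsupp)
  exact (tendstoUniformlyOn_truncGrad hK hγ hf hρ hsupp).continuousOn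
    (Eventually.of_forall fun n =>
      (continuous_truncGrad hK (epsSeq_pos hρ n) (hf.continuous hγ) hfc).continuousOn).frequently

/-- **Differentiability of the singular potential with the explicit gradient**
(Gilbarg–Trudinger §4.1 Lemma 4.2, (4.9); Majda–Bertozzi Prop. 2.20 / (4.49)): for a singular
kernel `K`, a `γ`-Hölder density `f` (`0 < γ`) supported in `B̄(x₀, ρ)`, and `x ∈ B(x₀, ρ/2)`,
`v = ∫ K(· − y) f(y) dy` has the Fréchet derivative `gradPotential K x₀ ρ f x` at `x`. Proof:
Mathlib's `hasFDerivAt_of_tendstoUniformlyOn` with the regularised potentials `v_{ε_n}`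
(`hasFDerivAt_truncPotential`, `norm_truncPotential_sub_singularPotential_le`,
`tendstoUniformlyOn_truncGrad`). [cite: GilbargTrudinger2001, §4.1 Lemma 4.2 (4.9)] -/
theorem hasFDerivAt_singularPotential (hK : IsC1SingularKernel K A) {γ C : ℝ≥0} (hγ : 0 < γ)
    {f : ℝ³ → V} (hf : HolderWith C γ f) {x₀ : ℝ³} {ρ : ℝ} (hρ : 0 < ρ)
    (hsupp : tsupport f ⊆ closedBall x₀ ρ) {x : ℝ³} (hx : ‖x - x₀‖ < ρ / 2) :
    HasFDerivAt (singularPotential K f) (gradPotential K x₀ ρ f x) x := by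
  have hfc : HasCompactSupport f :=
    HasCompactSupport.of_support_subset_isCompact (isCompact_closedBall x₀ ρ)
      ((subset_tsupport f).trans hsupp)
  have hfcont : Continuous f := hf.continuous hγ
  obtain ⟨M, hM⟩ := hfcont.bounded_above_of_compact_support hfc
  have hM0 : 0 ≤ M := (norm_nonneg _).trans (hM x)
  have hA := hK.nonneg
  refine hasFDerivAt_of_tendstoUniformlyOn (l := (atTop : Filter ℕ)) isOpen_ball
    (tendstoUniformlyOn_truncGrad hK hγ hf hρ hsupp)
    (fun n y _ => hasFDerivAt_truncPotential hK (epsSeq_pos hρ n) hfcont hfc y) (fun y _ => ?_)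
    (mem_ball_iff_norm.2 hx)
  -- pointwise convergence `v_{ε_n}(y) → v(y)`
  rw [tendsto_iff_norm_sub_tendsto_zero]
  refine squeeze_zero (fun n => norm_nonneg _)
    (fun n => norm_truncPotential_sub_singularPotential_le hK (epsSeq_pos hρ n) hfcont hfc hM y) ?_
  have := (tendsto_epsSeq ρ).const_mul (12 * π * A * M)
  simpa using this

/-- **The singular potential of a compactly supported Hölder density is `C¹`** (Gilbarg–Trudinger
§4.1 Lemma 4.2: `w ∈ C²(Ω)` for the Newtonian potential, i.e. `Dw ∈ C¹`; Majda–Bertozzi §4.1.3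
(4.39): `|K₃ f|_{1,γ} ≤ c ‖f‖_γ`, the qualitative part). For every `x`, taking `x₀ = 0` and `ρ`
large, `hasFDerivAt_singularPotential` applies, and on the ball `B(0, ρ/2) ∋ x` the derivative is
the continuous `gradPotential` (`continuousOn_gradPotential`). [cite: GilbargTrudinger2001, §4.1 Lemma 4.2] -/
theorem contDiff_singularPotential (hK : IsC1SingularKernel K A) {γ C : ℝ≥0} (hγ : 0 < γ)
    {f : ℝ³ → V} (hf : HolderWith C γ f) (hfc : HasCompactSupport f) :
    ContDiff ℝ 1 (singularPotential K f) := by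
  obtain ⟨R, hR⟩ := hfc.isCompact.isBounded.subset_closedBall (0 : ℝ³)
  -- for each point, a ball on which the derivative is `gradPotential K 0 ρ f`
  have key : ∀ x : ℝ³, ∃ ρ : ℝ, 0 < ρ ∧ tsupport f ⊆ closedBall 0 ρ ∧ ‖x - 0‖ < ρ / 2 := by
    intro x
    refine ⟨2 * (‖x‖ + |R| + 1), by positivity, hR.trans (closedBall_subset_closedBall ?_), ?_⟩
    · linarith [le_abs_self R, abs_nonneg R, norm_nonneg x]
    · rw [sub_zero]
      linarith [abs_nonneg R]
  have hdiff : ∀ x : ℝ³, ∃ ρ : ℝ, 0 < ρ ∧ tsupport f ⊆ closedBall 0 ρ ∧ ‖x - 0‖ < ρ / 2 ∧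
      ∀ y ∈ ball (0 : ℝ³) (ρ / 2), HasFDerivAt (singularPotential K f) (gradPotential K 0 ρ f y) y := by
    intro x
    obtain ⟨ρ, hρ, hs, hx⟩ := key x
    exact ⟨ρ, hρ, hs, hx, fun y hy => hasFDerivAt_singularPotential hK hγ hf hρ hs (mem_ball_iff_norm.1 hy)⟩
  rw [contDiff_one_iff_fderiv]
  refine ⟨fun x => ?_, continuous_iff_continuousAt.2 fun x => ?_⟩
  · obtain ⟨ρ, hρ, hs, hx, h⟩ := hdiff x
    exact (h x (mem_ball_iff_norm.2 hx)).differentiableAt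
  · obtain ⟨ρ, hρ, hs, hx, h⟩ := hdiff x
    have hball : ball (0 : ℝ³) (ρ / 2) ∈ 𝓝 x := isOpen_ball.mem_nhds (mem_ball_iff_norm.2 hx)
    have heq : fderiv ℝ (singularPotential K f) =ᶠ[𝓝 x] gradPotential K 0 ρ f := by
      filter_upwards [hball] with y hy
      exact (h y hy).fderiv
    refine (ContinuousAt.congr ?_ heq.symm)
    exact (continuousOn_gradPotential hK hγ hf hρ hs).continuousAt hball

/-- **The gradient formula** on `B(x₀, ρ/2)`: `∇v(x) = gradPotential K x₀ ρ f x`, i.e.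
`∇v(x) e = ∫ (∇K(x−y) e)(f y − χ y • f x) dy + ∫ (∂ₑχ)(y) • K(x−y) f(x) dy`
(Gilbarg–Trudinger (4.9)). [cite: GilbargTrudinger2001, §4.1 Lemma 4.2 (4.9)] -/
theorem fderiv_singularPotential (hK : IsC1SingularKernel K A) {γ C : ℝ≥0} (hγ : 0 < γ)
    {f : ℝ³ → V} (hf : HolderWith C γ f) {x₀ : ℝ³} {ρ : ℝ} (hρ : 0 < ρ)
    (hsupp : tsupport f ⊆ closedBall x₀ ρ) {x : ℝ³} (hx : ‖x - x₀‖ < ρ / 2) :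
    fderiv ℝ (singularPotential K f) x = gradPotential K x₀ ρ f x :=
  (hasFDerivAt_singularPotential hK hγ hf hρ hsupp hx).fderiv

end Main

end Literature.Analysis.FluidPDE
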